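import Summits.KontsevichZagierPeriods.KontsevichZagierPeriods.Theorems.RootDecompRelativeModAbsoluteCylLogSplitP27

/-! # `RootDecompRelativeModAbsoluteCylLogSplitP28` — part 3/27 of the mechanical ≤400-line split of `RungClosure.lean` (sha256 f909f334226f0fb5…)
Source: decomp-kz lens-3 g12 `RungClosure.lean` v9 (HOME/decomp-kz-lens-3/g12/, sha256 f909f334…; critic g4-52/g4-57/g5 CLEARED, «lander: split v9 --supports 30572»): BLOCK I (57 g11 monolith decls missing from P01–P25), BLOCK II/III (WildCertAssembly parts 1–6, 8–10: `Leaf.cellLocalWildCert`, `Leaf.cylKernelZeroLog_of_trees`), Parts 12–13 (`Leaf.regKernelPairDegOne_iff_circlePos_of_trees`), BLOCK G13 (Möbius engine, test §C decided).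
Split by census-1 g9 `gen/splitlean.py`: scopes re-opened with their `open`/`variable`/`set_option` context; mathematics and declaration order unchanged. -/

noncomputable section
open Set MeasureTheory Filter Topology
open scoped BigOperators
open Literature.NumberTheory.Transcendental Literature.ModelTheory.ExponentialFields
namespace Summit.KontsevichZagierPeriods.RootDecompRelativeModAbsolute.Rung30571
namespace RegularisedLogLayer
namespace CylLog
variable {b : ℕ}

/-- The three elements of `Fin 3` (file-local copy; the public twin lives in an unrelated Literature module). [bookkeeping] -/
private theorem fin3_cases (t : Fin 3) : t = 0 ∨ t = 1 ∨ t = 2 := by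
  fin_cases t <;> simp

open scoped ContDiff in

/-- **`CellCloseLS` on the TAME class — PROVED from `BoundaryRigidity` BY NAME.**  The binders are those of
`CellCloseLS` verbatim, plus the two TAMENESS bounds `hT1`, `hT2`. -/
theorem cellCloseLS_tame
    (hBR : Summit.KontsevichZagierPeriods.LiouvilleUnfolding.LogPrimitiveNL.Negative.BoundaryRigidity)
    (E : Set (Fin 1 → ℝ)) (V : KZ.IntegralRep (1 + 1)) (a₀ : (Fin 1 → ℝ) → ℝ) (q : ℕ)
    (c κ : Fin q → (Fin 1 → ℝ) → ℝ) (M : Fin q → ℕ) (σ : Fin q → Fin 3)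
    (R : ℕ) (f : Fin R → Fin q → ℤ) (qq : Fin R → (Fin 1 → ℝ) → ℝ)
    (hEo : IsOpen E) (hE : IsSemialgebraic ℚ E)
    (ha₀ : IsSemialgebraicFunOn ℚ E a₀) (_ha_sm : ContDiffOn ℝ ∞ a₀ E) (ha₀i : IntegrableOn a₀ E)
    (hc : ∀ i, IsSemialgebraicFunOn ℚ E (c i)) (_hc_sm : ∀ i, ContDiffOn ℝ ∞ (c i) E)
    (hκ : ∀ i, IsSemialgebraicFunOn ℚ E (κ i)) (hκ_sm : ∀ i, ContDiffOn ℝ ∞ (κ i) E)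
    (hκ1 : ∀ i, ∀ x ∈ E, -1 < κ i x)
    (hσ0 : ∀ i, σ i = 0 → ∀ x ∈ E, 0 < κ i x) (hσ1 : ∀ i, σ i = 1 → ∀ x ∈ E, κ i x < 0)
    (hσ2 : ∀ i, σ i = 2 → ∀ x ∈ E, κ i x = 0)
    (hint : ∀ i, IntegrableOn (fun z : Fin (1 + 1) → ℝ =>
      c i (Fin.init z) * (z (Fin.last 1) ^ M i / (1 + z (Fin.last 1) * κ i (Fin.init z))))
      {z : Fin (1 + 1) → ℝ | (Fin.init z : Fin 1 → ℝ) ∈ E ∧ z (Fin.last 1) ∈ Set.Ioo 0 1})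
    (hL1 : ∀ i, IntegrableOn (fun x => c i x * ∫ θ in Set.Ioo (0 : ℝ) 1, θ ^ M i / (1 + θ * κ i x)) E)
    (hdom : V.domain = {z : Fin (1 + 1) → ℝ | (Fin.init z : Fin 1 → ℝ) ∈ E ∧ z (Fin.last 1) ∈ Set.Ioo 0 1})
    (hV : Set.EqOn V.integrand (fun z => a₀ (Fin.init z) +
      ∑ i, c i (Fin.init z) * (z (Fin.last 1) ^ M i / (1 + z (Fin.last 1) * κ i (Fin.init z))))
      V.domain)
    (hpoly : ∀ x ∈ E, a₀ x + ∑ i, polyPart (sgnB σ) c κ M i x = 0)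
    (_hqq : ∀ r, IsSemialgebraicFunOn ℚ E (qq r))
    (hprod : ∀ r, ∀ x ∈ E, ∏ i, (1 + κ i x) ^ (f r i) = 1)
    (hcoef : ∀ i, ∀ x ∈ E, logCoef (sgnB σ) c κ M i x = ∑ r, qq r x * (f r i : ℝ))
    (hT1 : ∀ i, σ i ≠ 2 → IntegrableOn (fun x => c i x / κ i x ^ (M i + 1) * Real.log (1 + κ i x)) E)
    (hT2 : ∀ i, σ i = 0 → ∀ j, j < M i →
      IntegrableOn (fun x => c i x / κ i x ^ (M i + 1) * κ i x ^ (j + 1)) E) :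
    KZ.of V ∈ KZ.relations := by
  classical
  set cylE : Set (Fin (1 + 1) → ℝ) :=
    {z : Fin (1 + 1) → ℝ | (Fin.init z : Fin 1 → ℝ) ∈ E ∧ z (Fin.last 1) ∈ Set.Ioo 0 1} with hcylE
  have hEm : MeasurableSet E := hE.measurableSet_holds
  have hcyl : IsSemialgebraic ℚ cylE := RTerm.isSemialgebraic_cyl hE
  have hcylG : cylE ⊆ {z | (Fin.init z : Fin 1 → ℝ) ∈ E} := fun z hz => hz.1
  have h0sa : IsSemialgebraicFunOn ℚ E (fun _ => (0:ℝ)) :=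
    (isSemialgebraicFunOn_ratCast hE 0).congr fun _ _ => by simp
  have h1sa : IsSemialgebraicFunOn ℚ E (fun _ => (1:ℝ)) :=
    (isSemialgebraicFunOn_ratCast hE 1).congr fun _ _ => by simp
  have hband : IsSemialgebraic ℚ (KZlog.band E (fun _ => (0:ℝ)) (fun _ => 1)) :=
    KZlog.isSemialgebraic_band h0sa h1sa
  have hbandG : KZlog.band E (fun _ => (0:ℝ)) (fun _ => 1) ⊆ {z | (Fin.init z : Fin 1 → ℝ) ∈ E} :=
    fun z hz => hz.1
  have hcyl_band : cylE ⊆ KZlog.band E (fun _ => (0:ℝ)) (fun _ => 1) :=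
    fun z hz => ⟨hz.1, hz.2.1.le, hz.2.2.le⟩
  -- no poles on the closed band
  have hden_band : ∀ i, ∀ z ∈ KZlog.band E (fun _ => (0:ℝ)) (fun _ => 1),
      1 + z (Fin.last 1) * κ i (Fin.init z) ≠ 0 := fun i z hz =>
    (one_add_mul_pos_of_gt_neg_one hz.2.1 hz.2.2 (hκ1 i _ hz.1)).ne'
  have hden_cyl : ∀ i, ∀ z ∈ cylE, 1 + z (Fin.last 1) * κ i (Fin.init z) ≠ 0 :=
    fun i z hz => hden_band i z (hcyl_band hz)
  -- the pieces on the open cylinder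
  have hTm_cyl : ∀ i, IsSemialgebraicFunOn ℚ cylE (fun z => c i (Fin.init z) *
      (z (Fin.last 1) ^ M i / (1 + z (Fin.last 1) * κ i (Fin.init z)))) :=
    fun i => sa_cylTerm (M i) hcyl hcylG (hc i) (hκ i) (hden_cyl i)
  have hTm_band : ∀ i, IsSemialgebraicFunOn ℚ (KZlog.band E (fun _ => (0:ℝ)) (fun _ => 1))
      (fun z => c i (Fin.init z) * (z (Fin.last 1) ^ M i / (1 + z (Fin.last 1) * κ i (Fin.init z)))) :=
    fun i => sa_cylTerm (M i) hband hbandG (hc i) (hκ i) (hden_band i)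
  have ha₀cyl : IsSemialgebraicFunOn ℚ cylE (fun z => a₀ (Fin.init z)) := ha₀.comp_init.mono hcylG hcyl
  have ha₀band : IsSemialgebraicFunOn ℚ (KZlog.band E (fun _ => (0:ℝ)) (fun _ => 1))
      (fun z => a₀ (Fin.init z)) := ha₀.comp_init.mono hbandG hband
  have hA₀int : IntegrableOn (fun z : Fin (1 + 1) → ℝ => a₀ (Fin.init z))
      (KZlog.band E (fun _ => (0:ℝ)) (fun _ => 1)) := integrableOn_comp_init_band hE ha₀ ha₀i
  let A : KZ.IntegralRep (1 + 1) :=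
    { domain := cylE, integrand := fun z => a₀ (Fin.init z), isSemialgebraic_domain := hcyl,
      isSemialgebraicFunOn_integrand := ha₀cyl, integrableOn := hA₀int.mono_set hcyl_band }
  let Cy : Fin q → KZ.IntegralRep (1 + 1) := fun i =>
    { domain := cylE,
      integrand := fun z => c i (Fin.init z) * (z (Fin.last 1) ^ M i / (1 + z (Fin.last 1) * κ i (Fin.init z))),
      isSemialgebraic_domain := hcyl, isSemialgebraicFunOn_integrand := hTm_cyl i, integrableOn := hint i }
  -- (1) D1: split the integrand
  have r1 : KZ.of V - KZ.of A - ∑ i, KZ.of (Cy i) ∈ KZ.relations :=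
    KZ.of_sub_of_sub_sum_mem_relations q V A Cy (by rw [hdom]) (fun i => by rw [hdom])
      fun z hz => by rw [hV hz]
  -- (2) the `θ`-constant term: open → closed band → base `[E, a₀]`
  obtain ⟨A', hA'd, hA'i, r2⟩ := exists_closedBand_of_openCell' (a := fun _ => (0:ℝ))
    (c := fun _ => (1:ℝ)) h0sa h1sa A rfl (fun z => a₀ (Fin.init z)) ha₀band (fun _ _ => rfl)
  obtain ⟨Ba, hBad, hBai, r3⟩ := exists_base_of_thetaConst hE ha₀ ha₀i A' hA'd hA'i
  -- (3) the per-index packages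
  let d : Fin q → (Fin 1 → ℝ) → ℝ := fun i x => c i x / κ i x ^ (M i + 1)
  let W : Fin q → (Fin 1 → ℝ) → ℝ := fun i x => 1 + κ i x
  let σB : Fin q → Bool := fun i => decide (σ i ≠ 1)
  let ε : Fin q → ℤ := fun i => if σB i then 1 else -1
  let Dom : Fin q → Set (Fin (1 + 1) → ℝ) := fun i =>
    if σB i then KZlog.band E (fun _ => 1) (W i) else KZlog.band E (W i) (fun _ => 1)
  have hWsa : ∀ i, IsSemialgebraicFunOn ℚ E (W i) := fun i => IsSemialgebraicFunOn.add_holds h1sa (hκ i)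
  have hκd : ∀ i, DifferentiableOn ℝ (κ i) E := fun i => (hκ_sm i).differentiableOn (by simp)
  have hWd : ∀ i, DifferentiableOn ℝ (W i) E := fun i => (differentiableOn_const _).add (hκd i)
  have hci2 : ∀ i, σ i = 2 → IntegrableOn (c i) E := by
    intro i h2
    refine IntegrableOn.congr_fun (((hL1 i).mul_const ((M i : ℝ) + 1))) (fun x hx => ?_) hEm
    have hM : ((M i : ℝ) + 1) ≠ 0 := by positivity
    simp only [hσ2 i h2 x hx, fibreIntegral_zero]
    field_simp
  have hX : ∀ i, ∃ (P : KZ.IntegralRep (1 + 1)) (Bb : KZ.IntegralRep 1),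
      P.domain = Dom i ∧
      EqOn P.integrand (fun z => d i (Fin.init z) * ((z (Fin.last 1) - 1) ^ M i / z (Fin.last 1))) P.domain ∧
      Bb.domain = E ∧ (Bb.integrand = fun x => if σ i = 2 then c i x / ((M i : ℝ) + 1) else 0) ∧
      KZ.of (Cy i) - ε i • KZ.of P - KZ.of Bb ∈ KZ.relations := by
    intro i
    -- the zero base representation
    let Z : KZ.IntegralRep 1 :=
      { domain := E, integrand := fun _ => 0, isSemialgebraic_domain := hE,
        isSemialgebraicFunOn_integrand := h0sa, integrableOn := integrableOn_zero }
    have hZ : KZ.of Z ∈ KZ.relations := KZ.of_mem_relations_of_eqOn_zero Z fun _ _ => rfl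
    rcases fin3_cases (σ i) with h0 | h1 | h2
    · -- `κᵢ > 0`: closed band, then D4 (`exists_regRep_sub_mem_relations`)
      have hσB : σB i = true := by simp [σB, h0]
      have hε : ε i = 1 := by simp [ε, hσB]
      obtain ⟨Cy', hCy'd, hCy'i, r4⟩ := exists_closedBand_of_openCell' (a := fun _ => (0:ℝ))
        (c := fun _ => (1:ℝ)) h0sa h1sa (Cy i) rfl _ (hTm_band i) (fun _ _ => rfl)
      obtain ⟨Rg, hRgd, hRgi, r5⟩ := exists_regRep_sub_mem_relations (M := M i) hEo hE (hc i) (hκ i)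
        (hκd i) (hσ0 i h0) Cy' hCy'd (fun z _ => by rw [hCy'i])
      refine ⟨Rg, Z, ?_, ?_, rfl, ?_, ?_⟩
      · simp only [Dom, hσB]; exact hRgd
      · intro z _; rw [hRgi]
      · funext x; show (0:ℝ) = _; simp [h0]
      · rw [hε, one_smul]
        have h := KZ.relations.sub_mem (KZ.relations.add_mem r4 r5) hZ
        convert h using 1
        abel
    · -- `κᵢ < 0`: closed band, then D4⁻ (`exists_regNegRep_sub_mem_relations`) and the sign flip
      have hσB : σB i = false := by simp [σB, h1]
      have hε : ε i = -1 := by simp [ε, hσB]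
      obtain ⟨Cy', hCy'd, hCy'i, r4⟩ := exists_closedBand_of_openCell' (a := fun _ => (0:ℝ))
        (c := fun _ => (1:ℝ)) h0sa h1sa (Cy i) rfl _ (hTm_band i) (fun _ _ => rfl)
      obtain ⟨Rg, hRgd, hRgi, r5⟩ := exists_regNegRep_sub_mem_relations (M := M i) hEo hE (hc i) (hκ i)
        (hκd i) (hσ1 i h1) (hκ1 i) Cy' hCy'd (fun z _ => by rw [hCy'i])
      let R' : KZ.IntegralRep (1 + 1) :=
        { domain := Rg.domain, integrand := fun z => -Rg.integrand z,
          isSemialgebraic_domain := Rg.isSemialgebraic_domain,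
          isSemialgebraicFunOn_integrand := Rg.isSemialgebraicFunOn_integrand.neg,
          integrableOn := Rg.integrableOn.neg }
      have r6 : KZ.of Rg + KZ.of R' ∈ KZ.relations :=
        KZ.of_add_of_mem_relations_of_eqOn_neg (r := Rg) (r' := R') rfl fun z _ => rfl
      refine ⟨R', Z, ?_, ?_, rfl, ?_, ?_⟩
      · simp only [Dom, hσB]; exact hRgd
      · intro z _
        show -Rg.integrand z = _
        rw [hRgi]
        ring
      · funext x; show (0:ℝ) = _; simp [h1]
      · rw [hε, neg_smul, one_smul, sub_neg_eq_add]
        have h := KZ.relations.sub_mem (KZ.relations.add_mem (KZ.relations.add_mem r4 r5) r6) hZ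
        convert h using 1
        abel
    · -- `κᵢ ≡ 0`: closed band with the MONOMIAL integrand, fold to the base; the cell is a dummy zero cell
      have hσB : σB i = true := by simp [σB, h2]
      have hε : ε i = 1 := by simp [ε, hσB]
      have hmono : IsSemialgebraicFunOn ℚ (KZlog.band E (fun _ => (0:ℝ)) (fun _ => 1))
          (fun z => c i (Fin.init z) * z (Fin.last 1) ^ M i) :=
        IsSemialgebraicFunOn.mul_holds ((hc i).comp_init.mono hbandG hband)
          (isSemialgebraicFunOn_pow' hband (Literature.NumberTheory.Transcendental.isSemialgebraicFunOn_apply hband (Fin.last 1)) (M i))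
      obtain ⟨Cy', hCy'd, hCy'i, r4⟩ := exists_closedBand_of_openCell' (a := fun _ => (0:ℝ))
        (c := fun _ => (1:ℝ)) h0sa h1sa (Cy i) rfl _ hmono (fun z hz => by
          have hx : Fin.init z ∈ E := hz.1
          show c i (Fin.init z) * (z (Fin.last 1) ^ M i / (1 + z (Fin.last 1) * κ i (Fin.init z))) = _
          rw [hσ2 i h2 _ hx, mul_zero, add_zero, div_one])
      obtain ⟨Bb, hBbd, hBbi, r5⟩ := exists_base_of_monomial (M := M i) hE (hc i) (hci2 i h2) Cy' hCy'd hCy'i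
      let Pd : KZ.IntegralRep (1 + 1) :=
        { domain := KZlog.band E (fun _ => 1) (W i), integrand := fun _ => 0,
          isSemialgebraic_domain := KZlog.isSemialgebraic_band h1sa (hWsa i),
          isSemialgebraicFunOn_integrand :=
            (isSemialgebraicFunOn_ratCast (KZlog.isSemialgebraic_band h1sa (hWsa i)) 0).congr
              fun _ _ => by simp,
          integrableOn := integrableOn_zero }
      have hPd0 : KZ.of Pd ∈ KZ.relations := KZ.of_mem_relations_of_eqOn_zero Pd fun _ _ => rfl
      refine ⟨Pd, Bb, ?_, ?_, hBbd, ?_, ?_⟩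
      · simp only [Dom, hσB]; rfl
      · intro z hz
        have hx : Fin.init z ∈ E := hz.1
        show (0:ℝ) = d i (Fin.init z) * _
        simp only [d, hσ2 i h2 _ hx, zero_pow (Nat.succ_ne_zero _), div_zero, zero_mul]
      · rw [hBbi]; funext x; simp [h2]
      · rw [hε, one_smul]
        have h := KZ.relations.sub_mem (KZ.relations.add_mem r4 r5) hPd0
        convert h using 1
        abel
  choose P Bb hPd hPi hBbd hBbi hXr using hX
  -- (4) the hypotheses of `tameClose`
  have hk0 : ∀ i, σ i ≠ 2 → ∀ x ∈ E, κ i x ≠ 0 := by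
    intro i h2 x hx
    rcases fin3_cases (σ i) with h0 | h1 | h2'
    · exact (hσ0 i h0 x hx).ne'
    · exact (hσ1 i h1 x hx).ne
    · exact absurd h2' h2
  have hdsa : ∀ i, IsSemialgebraicFunOn ℚ E (d i) := by
    intro i
    by_cases h2 : σ i = 2
    · refine h0sa.congr fun x hx => ?_
      show (0:ℝ) = c i x / κ i x ^ (M i + 1)
      rw [hσ2 i h2 x hx, zero_pow (Nat.succ_ne_zero _), div_zero]
    · exact IsSemialgebraicFunOn.div (hc i) (isSemialgebraicFunOn_pow' hE (hκ i) (M i + 1))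
        fun x hx => pow_ne_zero _ (hk0 i h2 x hx)
  have hσt : ∀ i, σB i = true → ∀ x ∈ E, 1 ≤ W i x := by
    intro i hi x hx
    have hne : σ i ≠ 1 := by simpa [σB] using hi
    show 1 ≤ 1 + κ i x
    rcases fin3_cases (σ i) with h0 | h1 | h2
    · linarith [hσ0 i h0 x hx]
    · exact absurd h1 hne
    · rw [hσ2 i h2 x hx]; simp
  have hσf : ∀ i, σB i = false → ∀ x ∈ E, 0 < W i x ∧ W i x ≤ 1 := by
    intro i hi x hx
    have h1 : σ i = 1 := by simpa [σB] using hi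
    show 0 < 1 + κ i x ∧ 1 + κ i x ≤ 1
    exact ⟨by linarith [hκ1 i x hx], by linarith [hσ1 i h1 x hx]⟩
  have hlog : ∀ i, IntegrableOn (fun x => d i x * Real.log (W i x)) E := by
    intro i
    by_cases h2 : σ i = 2
    · refine IntegrableOn.congr_fun integrableOn_zero (fun x hx => ?_) hEm
      show (0:ℝ) = c i x / κ i x ^ (M i + 1) * Real.log (1 + κ i x)
      rw [hσ2 i h2 x hx]; simp
    · exact hT1 i h2
  have hpow : ∀ i, σB i = true → ∀ j, j < M i → IntegrableOn (fun x => d i x * (W i x - 1) ^ (j + 1)) E := by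
    intro i hi j hj
    have hne : σ i ≠ 1 := by simpa [σB] using hi
    rcases fin3_cases (σ i) with h0 | h1 | h2
    · refine IntegrableOn.congr_fun (hT2 i h0 j hj) (fun x _ => ?_) hEm
      show c i x / κ i x ^ (M i + 1) * κ i x ^ (j + 1) = c i x / κ i x ^ (M i + 1) * (1 + κ i x - 1) ^ (j + 1)
      rw [add_sub_cancel_left]
    · exact absurd h1 hne
    · refine IntegrableOn.congr_fun integrableOn_zero (fun x hx => ?_) hEm
      show (0:ℝ) = c i x / κ i x ^ (M i + 1) * (1 + κ i x - 1) ^ (j + 1)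
      rw [hσ2 i h2 x hx]; simp
  have hsum : ∀ x ∈ E, ∑ i, (-1) ^ M i * d i x * Real.log (W i x) = 0 := by
    intro x hx
    have hW0 : ∀ i, 0 < W i x := fun i => by show 0 < 1 + κ i x; linarith [hκ1 i x hx]
    have hterm : ∀ i, (-1) ^ M i * d i x * Real.log (W i x) =
        logCoef (sgnB σ) c κ M i x * Real.log (W i x) := by
      intro i
      by_cases h2 : σ i = 2
      · have hs : sgnB σ i = false := by simp [sgnB, h2]
        show (-1) ^ M i * (c i x / κ i x ^ (M i + 1)) * Real.log (1 + κ i x) =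
          logCoef (sgnB σ) c κ M i x * Real.log (1 + κ i x)
        simp [logCoef, hs, hσ2 i h2 x hx]
      · have hs : sgnB σ i = true := by simp [sgnB, h2]
        simp only [logCoef, hs, if_true, d]
        ring
    have hlogsum : ∀ r, ∑ i, (f r i : ℝ) * Real.log (W i x) = 0 := by
      intro r
      have h := congrArg Real.log (hprod r x hx)
      rw [Real.log_one, Real.log_prod (fun i _ => zpow_ne_zero _ (hW0 i).ne')] at h
      simpa only [Real.log_zpow] using h
    have hswap : ∑ i, (∑ r, qq r x * (f r i : ℝ)) * Real.log (W i x) =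
        ∑ r, qq r x * ∑ i, (f r i : ℝ) * Real.log (W i x) := by
      simp only [Finset.sum_mul, Finset.mul_sum, mul_assoc]
      exact Finset.sum_comm
    calc ∑ i, (-1) ^ M i * d i x * Real.log (W i x)
        = ∑ i, logCoef (sgnB σ) c κ M i x * Real.log (W i x) := Finset.sum_congr rfl fun i _ => hterm i
      _ = ∑ i, (∑ r, qq r x * (f r i : ℝ)) * Real.log (W i x) :=
          Finset.sum_congr rfl fun i _ => by rw [hcoef i x hx]
      _ = ∑ r, qq r x * ∑ i, (f r i : ℝ) * Real.log (W i x) := hswap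
      _ = 0 := by simp [hlogsum]
  -- (5) the consolidated base `B = [E, −(a₀ + Σ Bbᵢ)] ≡ [E, Σ dᵢ polyLog_{Mᵢ}(Wᵢ)]` (by `hpoly`)
  have hBbsa : ∀ i, IsSemialgebraicFunOn ℚ E (Bb i).integrand := fun i => by
    rw [← hBbd i]; exact (Bb i).isSemialgebraicFunOn_integrand
  have hBbint : ∀ i, IntegrableOn (Bb i).integrand E := fun i => by
    rw [← hBbd i]; exact (Bb i).integrableOn
  let Bsum : KZ.IntegralRep 1 :=
    { domain := E, integrand := fun x => a₀ x + ∑ i, (Bb i).integrand x, isSemialgebraic_domain := hE,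
      isSemialgebraicFunOn_integrand := IsSemialgebraicFunOn.add_holds ha₀
        (KZ.isSemialgebraicFunOn_finset_sum Finset.univ hE fun i _ => hBbsa i),
      integrableOn := ha₀i.add (integrable_finsetSum Finset.univ fun i _ => hBbint i) }
  let B : KZ.IntegralRep 1 :=
    { domain := E, integrand := fun x => -(a₀ x + ∑ i, (Bb i).integrand x), isSemialgebraic_domain := hE,
      isSemialgebraicFunOn_integrand := Bsum.isSemialgebraicFunOn_integrand.neg,
      integrableOn := Bsum.integrableOn.neg }
  have rb1 : KZ.of Bsum - KZ.of Ba - ∑ i, KZ.of (Bb i) ∈ KZ.relations :=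
    KZ.of_sub_of_sub_sum_mem_relations q Bsum Ba Bb hBad (fun i => hBbd i) fun x _ => by
      show a₀ x + ∑ i, (Bb i).integrand x = Ba.integrand x + ∑ i, (Bb i).integrand x
      rw [hBai]
  have rb2 : KZ.of Bsum + KZ.of B ∈ KZ.relations :=
    KZ.of_add_of_mem_relations_of_eqOn_neg (r := Bsum) (r' := B) rfl fun _ _ => rfl
  have hBi : EqOn B.integrand (fun x => ∑ i, d i x * polyLog (M i) (W i x)) E := by
    intro x hx
    show -(a₀ x + ∑ i, (Bb i).integrand x) = ∑ i, d i x * polyLog (M i) (W i x)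
    have hp := hpoly x hx
    have hpp : ∀ i, polyPart (sgnB σ) c κ M i x = (Bb i).integrand x + d i x * polyLog (M i) (W i x) := by
      intro i
      rw [hBbi i]
      by_cases h2 : σ i = 2
      · have hs : sgnB σ i = false := by simp [sgnB, h2]
        show polyPart (sgnB σ) c κ M i x =
          (if σ i = 2 then c i x / ((M i : ℝ) + 1) else 0) + c i x / κ i x ^ (M i + 1) * polyLog (M i) (1 + κ i x)
        simp [polyPart, hs, h2, hσ2 i h2 x hx]
      · have hs : sgnB σ i = true := by simp [sgnB, h2]
        show polyPart (sgnB σ) c κ M i x =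
          (if σ i = 2 then c i x / ((M i : ℝ) + 1) else 0) + c i x / κ i x ^ (M i + 1) * polyLog (M i) (1 + κ i x)
        simp only [polyPart, hs, h2, if_true, if_false, zero_add]
        ring
    rw [Finset.sum_congr rfl fun i _ => hpp i, Finset.sum_add_distrib] at hp
    linarith
  -- (6) the tame class closes
  have hT := tameClose hBR hEo hE d W M hdsa hWsa hWd σB hσt hσf hlog hpow hsum P hPd hPi B rfl hBi
  -- (7) assemble
  have hXs := sum_mem fun i (_ : i ∈ (Finset.univ : Finset (Fin q))) => hXr i
  have key : KZ.of V = (KZ.of V - KZ.of A - ∑ i, KZ.of (Cy i)) + (KZ.of A - KZ.of A') +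
      (KZ.of A' - KZ.of Ba) + ∑ i, (KZ.of (Cy i) - ε i • KZ.of (P i) - KZ.of (Bb i)) +
      (∑ i, ε i • KZ.of (P i) - KZ.of B) - (KZ.of Bsum - KZ.of Ba - ∑ i, KZ.of (Bb i)) +
      (KZ.of Bsum + KZ.of B) := by
    simp only [Finset.sum_sub_distrib]
    abel
  rw [key]
  exact KZ.relations.add_mem (KZ.relations.sub_mem (KZ.relations.add_mem (KZ.relations.add_mem
    (KZ.relations.add_mem (KZ.relations.add_mem r1 r2) r3) hXs) hT) rb1) rb2

/-! ### §3ah THE TYPED SPLIT OF THE RESIDUAL: `CellCloseLS ⟺ CellCloseLSTame ∧ CellCloseLSWild` (PROVED),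
`BoundaryRigidity → CellCloseLSTame` (PROVED), hence `LogStructure → BoundaryRigidity → CellCloseLSWild → CylKernelZeroLog`
(PROVED) — the log kind is reduced to its WILD cells (g11). -/

/-- **TAMENESS** of a cell of exact integer relations (data of `CellCloseLS`): the regularised coefficients
`dᵢ = cᵢ/κᵢ^{Mᵢ+1}` (`κᵢ ≢ 0`) satisfy `dᵢ·log(1+κᵢ) ∈ L¹(E)`, and `dᵢ·κᵢ^{j+1} ∈ L¹(E)` for `κᵢ > 0`, `j < Mᵢ`.
Automatic from the cylinder integrability at every end of `E` except a `κᵢ → 0` end with `Mᵢ ≥ 1`. -/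
def TameCell {q : ℕ} (E : Set (Fin 1 → ℝ)) (c κ : Fin q → (Fin 1 → ℝ) → ℝ) (M : Fin q → ℕ)
    (σ : Fin q → Fin 3) : Prop :=
  (∀ i, σ i ≠ 2 → IntegrableOn (fun x => c i x / κ i x ^ (M i + 1) * Real.log (1 + κ i x)) E) ∧
  (∀ i, σ i = 0 → ∀ j, j < M i →
    IntegrableOn (fun x => c i x / κ i x ^ (M i + 1) * κ i x ^ (j + 1)) E)

end CylLog
end RegularisedLogLayer
end Summit.KontsevichZagierPeriods.RootDecompRelativeModAbsolute.Rung30571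
end
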